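import Summits.ABC.IUTFork.Conditional.FreyLegendreP6EngineList
import Literature.NumberTheory.EllipticCurves.PointCountEulerCriterion
import Literature.NumberTheory.EllipticCurves.ComplexMultiplicationLocalFactorsAux
import HarnessLib

/-!
# (P6) IN KERNEL at the Frey–Legendre data HEX λ_5 = 1/2 + 2/7⁵ = (7⁵+4)/(2·7⁵) (24 tabulated l) · HEX λ_6 = 1/2 + 2/7⁶ = (7⁶+4)/(2·7⁶) (24 tabulated l) — every prime `l` tabulated in the R-W WINDOW-TABLE

PROOF-ONLY file (D-0012; 0 definitions, 0 `Prop` facts, no instance, no notation) of the abc-iut cell (seat abc-iut-w6-d102, gen 5;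
row «C:P6-KERNEL-N3» = the N3 universe of plan/rescue/R-W/WINDOW-TABLE.tsv v4.25 (abc-iut-rw-num-lead), whose column «admissible»
reads «P6: Serre-witnessed (W-num-3, p ≤ 37; kernel: NOT certified)» at these data). For each datum `λ = a/c` below (spelled VERBATIM
as in the tree's K/M rows) and EVERY tabulated prime `l`, `Cor22.CondP6 (ratPoint λ) l` — the image of `Gal(F̄/F)` on `E_F[l]`
contains `SL₂(𝔽_l)` for every theta-field `F` ([IUTchIV] Cor. 2.2 (ii) (P6) p. 46 / [IUTchI] Def. 3.1 (c)) — is a THEOREM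
(`<Tag>.condP6_tabulated`), by the LIST ENGINE `FreyP6Engine.condP6_ratPoint_of_certificate_list` (p484675) on the integer model
`E₁ = [0, −(c²+ac), 0, ac³, 0]` of `y² = x(x−1)(x−λ)`: ONE multiplicative prime `q ∣ ab` (`q ∤ c₄(E₁)`, `Δ(E₁) = 16a²c⁸b² = q^k·D`,
`q ∤ D`), a few good primes `p` with KERNEL point counts `#Ẽ₁(𝔽_p)` (Euler's criterion) hence `a_p`, and per certificate prime ONE
`decide +kernel` for the side conditions `l.Prime ∧ l ∤ 46080 ∧ q ∤ l ∧ l ∤ k ∧ p ≠ l` and ONE for the `ℕ`-rootlessness of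
`X² − a_pX + p` mod every listed `l` (Mazur's Frobenius certificate ⇒ `ρ̄_l` irreducible; Tate transvection at `q` ⇒ `⊇ SL₂(𝔽_l)`).

* **HEX λ_5 = 1/2 + 2/7⁵ = (7⁵+4)/(2·7⁵) (24 tabulated l)**: `ratPoint (((7 ^ 5 + 4 : ℕ) : ℚ) / (2 * 7 ^ 5 : ℕ))`, 24 primes `11 ≤ l ≤ 107`; multiplicative
  prime(s) [3]; certificates p = 5: E₁ mod 5 = [0,0,0,4,0], #Ẽ₁ = 8, a_5 = -2; p = 11: E₁ mod 11 = [0,2,0,9,0], #Ẽ₁ = 16, a_11 = -4; p = 17: E₁ mod 17 = [0,2,0,5,0], #Ẽ₁ = 24, a_17 = -6.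
* **HEX λ_6 = 1/2 + 2/7⁶ = (7⁶+4)/(2·7⁶) (24 tabulated l)**: `ratPoint (((7 ^ 6 + 4 : ℕ) : ℚ) / (2 * 7 ^ 6 : ℕ))`, 24 primes `11 ≤ l ≤ 107`; multiplicative
  prime(s) [3]; certificates p = 13: E₁ mod 13 = [0,2,0,2,0], #Ẽ₁ = 16, a_13 = -2; p = 17: E₁ mod 17 = [0,3,0,13,0], #Ẽ₁ = 16, a_17 = 2; p = 41: E₁ mod 41 = [0,23,0,17,0], #Ẽ₁ = 48, a_41 = -6; p = 43: E₁ mod 43 = [0,29,0,40,0], #Ẽ₁ = 40, a_43 = 4.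

K2 (C-R66 (c)): source #1 = this seat's generator `p6gen.py` (HOME/staging/w6/w6-d102/g5/; two independent code paths per prime —
`y`-enumeration and Euler-criterion column sum — agree on every `#Ẽ₁(𝔽_p)`; per-datum tables `K2-<tag>.txt` staged alongside);
source #2 = abc-iut-W-num-3's Serre-witness column of WINDOW-TABLE v4.25 (desk `p ≤ 37` witnesses at the same data). The kernel's
`decide` is the arbiter of every number in this file.

HONEST SCOPE: classical, undisputed arithmetic of one elliptic curve over `ℚ` per datum (Serre 1972 / Mazur 1978 / a Tate transvection);
it turns the table's (P6) column at these data into kernel theorems (hence, with (P2)/(P5)/core/`UP` as typed, the datum types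
`ThetaVolumeDatumAt (ratPoint λ) l` are inhabited via `ThetaPartII.stub_thetaData` — the non-vacuity input of the «refuted by
unconditional theorem» rows), nothing more; nothing here is about Θ-data or [IUTchIII] Cor. 3.12; refuted-as-typed ≠ refuted-in-print;
no side taken on any author; typed ≠ proved for every IUT sentence; no abc claim.
[cite: Mochizuki2012, IUTchIV Cor. 2.2 (ii) proof (P6) p. 46; IUTchI Def. 3.1 (c) p. 62] [cite: Mazur1978, §6 Prop. 6.3 (1) p. 153]
[cite: MochizukiGenEll2010, Lem. 3.1 (iii) p. 14] [cite: SilvermanAEC2009, VII.5 Prop. 5.1(b), III.1 Table 3.1]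
[claim: Mochizuki2012, status: disputed] for every IUT quotation.
-/

noncomputable section

open scoped Classical
open WeierstrassCurve

namespace Summit.ABC.IUTFork.Conditional

open Literature.NumberTheory.EllipticCurves Literature.NumberTheory.DiophantineGeometry.GenEll
open Literature.NumberTheory.DiophantineGeometry Literature.IUT.LogVolume
namespace FreyP6Hex5

/-! ## Datum `λ = (7 ^ 5 + 4)/(2 * 7 ^ 5)` (`a + b = c` with `b = c − a`); model `E₁ = [0, −(c²+ac), 0, ac³, 0]` -/

/-- `3 ∤ c₄(E₁)` (`c₄ = 16c²(c²−ac+a²)`, `3 ∣ b = c − a`, `gcd(a,c) = 1`). [cite: SilvermanAEC2009, VII.5 Prop. 5.1(b)] -/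
theorem not_dvd_c₄_3 : ¬ ((3 : ℕ) : ℤ) ∣ ((
      ⟨0, -(((2 * 7 ^ 5 : ℕ) : ℤ) ^ 2 + (7 ^ 5 + 4 : ℕ) * (2 * 7 ^ 5 : ℕ)), 0,
        ((7 ^ 5 + 4 : ℕ) : ℤ) * ((2 * 7 ^ 5 : ℕ) : ℤ) ^ 3, 0⟩ : WeierstrassCurve ℤ)).c₄ := by
  rw [FreyP6Engine.c₄_model]; norm_num

/-- `Δ(E₁) = 16a²c⁸b² = 3^4 · D` (`ord_3 b = 2`). [cite: SilvermanAEC2009, III.1 Table 3.1] -/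
theorem Δ_eq_3 : ((
      ⟨0, -(((2 * 7 ^ 5 : ℕ) : ℤ) ^ 2 + (7 ^ 5 + 4 : ℕ) * (2 * 7 ^ 5 : ℕ)), 0,
        ((7 ^ 5 + 4 : ℕ) : ℤ) * ((2 * 7 ^ 5 : ℕ) : ℤ) ^ 3, 0⟩ : WeierstrassCurve ℤ)).Δ =
      (3 : ℕ) ^ 4 * (16 * ((7 ^ 5 + 4 : ℕ) : ℤ) ^ 2 * ((2 * 7 ^ 5 : ℕ) : ℤ) ^ 8 * (1867 : ℤ) ^ 2) := by
  rw [FreyP6Engine.Δ_model]; norm_num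

/-- `3 ∤ D`. [folklore] -/
theorem not_dvd_D_3 : ¬ ((3 : ℕ) : ℤ) ∣ (16 * ((7 ^ 5 + 4 : ℕ) : ℤ) ^ 2 * ((2 * 7 ^ 5 : ℕ) : ℤ) ^ 8 * (1867 : ℤ) ^ 2) := by
  norm_num

/-- `a_5(E₁) = 5 + 1 − #Ẽ₁(𝔽_5) = 5 + 1 − 8 = -2`: `E₁ mod 5 = [0, 0, 0, 4, 0]` (`decide +kernel`) and the point count
`#Ẽ₁(𝔽_5) = 8` is a KERNEL computation (Euler's criterion, `card_sol_eq_sum_euler` / `natCard_point_eq_one_add_card`). [folklore] -/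
theorem frobeniusTrace_5 : Literature.NumberTheory.Automorphic.frobeniusTrace
    (
      ⟨0, -(((2 * 7 ^ 5 : ℕ) : ℤ) ^ 2 + (7 ^ 5 + 4 : ℕ) * (2 * 7 ^ 5 : ℕ)), 0,
        ((7 ^ 5 + 4 : ℕ) : ℤ) * ((2 * 7 ^ 5 : ℕ) : ℤ) ^ 3, 0⟩ : WeierstrassCurve ℤ) 5 = -2 := by
  have hm : ((
      ⟨0, -(((2 * 7 ^ 5 : ℕ) : ℤ) ^ 2 + (7 ^ 5 + 4 : ℕ) * (2 * 7 ^ 5 : ℕ)), 0,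
        ((7 ^ 5 + 4 : ℕ) : ℤ) * ((2 * 7 ^ 5 : ℕ) : ℤ) ^ 3, 0⟩ : WeierstrassCurve ℤ)).map (Int.castRingHom (ZMod 5)) = ⟨0, 0, 0, 4, 0⟩ := by
    ext <;> decide +kernel
  have hc : Nat.card (⟨0, 0, 0, 4, 0⟩ : WeierstrassCurve (ZMod 5)).toAffine.Point = 8 := by
    rw [@WeierstrassCurve.natCard_point_eq_one_add_card (ZMod 5) (@ZMod.instField 5 ⟨by norm_num⟩) _ _ _
      (by decide +kernel), @card_sol_eq_sum_euler (ZMod 5) (@ZMod.instField 5 ⟨by norm_num⟩) _ _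
      (by rw [ZMod.ringChar_zmod_n]; decide)]
    decide +kernel
  rw [Literature.NumberTheory.Automorphic.frobeniusTrace, Literature.NumberTheory.Automorphic.numPointsMod,
    hm, hc]; norm_num

/-- `a_11(E₁) = 11 + 1 − #Ẽ₁(𝔽_11) = 11 + 1 − 16 = -4`: `E₁ mod 11 = [0, 2, 0, 9, 0]` (`decide +kernel`) and the point count
`#Ẽ₁(𝔽_11) = 16` is a KERNEL computation (Euler's criterion, `card_sol_eq_sum_euler` / `natCard_point_eq_one_add_card`). [folklore] -/
theorem frobeniusTrace_11 : Literature.NumberTheory.Automorphic.frobeniusTrace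
    (
      ⟨0, -(((2 * 7 ^ 5 : ℕ) : ℤ) ^ 2 + (7 ^ 5 + 4 : ℕ) * (2 * 7 ^ 5 : ℕ)), 0,
        ((7 ^ 5 + 4 : ℕ) : ℤ) * ((2 * 7 ^ 5 : ℕ) : ℤ) ^ 3, 0⟩ : WeierstrassCurve ℤ) 11 = -4 := by
  have hm : ((
      ⟨0, -(((2 * 7 ^ 5 : ℕ) : ℤ) ^ 2 + (7 ^ 5 + 4 : ℕ) * (2 * 7 ^ 5 : ℕ)), 0,
        ((7 ^ 5 + 4 : ℕ) : ℤ) * ((2 * 7 ^ 5 : ℕ) : ℤ) ^ 3, 0⟩ : WeierstrassCurve ℤ)).map (Int.castRingHom (ZMod 11)) = ⟨0, 2, 0, 9, 0⟩ := by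
    ext <;> decide +kernel
  have hc : Nat.card (⟨0, 2, 0, 9, 0⟩ : WeierstrassCurve (ZMod 11)).toAffine.Point = 16 := by
    rw [@WeierstrassCurve.natCard_point_eq_one_add_card (ZMod 11) (@ZMod.instField 11 ⟨by norm_num⟩) _ _ _
      (by decide +kernel), @card_sol_eq_sum_euler (ZMod 11) (@ZMod.instField 11 ⟨by norm_num⟩) _ _
      (by rw [ZMod.ringChar_zmod_n]; decide)]
    decide +kernel
  rw [Literature.NumberTheory.Automorphic.frobeniusTrace, Literature.NumberTheory.Automorphic.numPointsMod,
    hm, hc]; norm_num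

/-- `a_17(E₁) = 17 + 1 − #Ẽ₁(𝔽_17) = 17 + 1 − 24 = -6`: `E₁ mod 17 = [0, 2, 0, 5, 0]` (`decide +kernel`) and the point count
`#Ẽ₁(𝔽_17) = 24` is a KERNEL computation (Euler's criterion, `card_sol_eq_sum_euler` / `natCard_point_eq_one_add_card`). [folklore] -/
theorem frobeniusTrace_17 : Literature.NumberTheory.Automorphic.frobeniusTrace
    (
      ⟨0, -(((2 * 7 ^ 5 : ℕ) : ℤ) ^ 2 + (7 ^ 5 + 4 : ℕ) * (2 * 7 ^ 5 : ℕ)), 0,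
        ((7 ^ 5 + 4 : ℕ) : ℤ) * ((2 * 7 ^ 5 : ℕ) : ℤ) ^ 3, 0⟩ : WeierstrassCurve ℤ) 17 = -6 := by
  have hm : ((
      ⟨0, -(((2 * 7 ^ 5 : ℕ) : ℤ) ^ 2 + (7 ^ 5 + 4 : ℕ) * (2 * 7 ^ 5 : ℕ)), 0,
        ((7 ^ 5 + 4 : ℕ) : ℤ) * ((2 * 7 ^ 5 : ℕ) : ℤ) ^ 3, 0⟩ : WeierstrassCurve ℤ)).map (Int.castRingHom (ZMod 17)) = ⟨0, 2, 0, 5, 0⟩ := by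
    ext <;> decide +kernel
  have hc : Nat.card (⟨0, 2, 0, 5, 0⟩ : WeierstrassCurve (ZMod 17)).toAffine.Point = 24 := by
    rw [@WeierstrassCurve.natCard_point_eq_one_add_card (ZMod 17) (@ZMod.instField 17 ⟨by norm_num⟩) _ _ _
      (by decide +kernel), @card_sol_eq_sum_euler (ZMod 17) (@ZMod.instField 17 ⟨by norm_num⟩) _ _
      (by rw [ZMod.ringChar_zmod_n]; decide)]
    decide +kernel
  rw [Literature.NumberTheory.Automorphic.frobeniusTrace, Literature.NumberTheory.Automorphic.numPointsMod,
    hm, hc]; norm_num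

/-- **(P6) at `ratPoint (((7 ^ 5 + 4 : ℕ) : ℚ) / (2 * 7 ^ 5 : ℕ))` for `l ∈ [11, 19, 23, 31, 43, 47, 59, 67, 71, 79, 83, 103, 107]`** —
multiplicative prime `3` (`ord Δ = 4`), Frobenius certificate `p = 5` (`a_5 = -2`; `X² − a_5X + 5` rootless mod each
listed `l`, ONE kernel `decide` over `ℕ`). [cite: Mochizuki2012, IUTchIV Cor. 2.2 (ii) (P6) p.46] -/
theorem condP6_of_mem_q3_p5 :
    ∀ l ∈ ([11, 19, 23, 31, 43, 47, 59, 67, 71, 79, 83, 103, 107] : List ℕ),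
      Cor22.CondP6 (ratPoint (((7 ^ 5 + 4 : ℕ) : ℚ) / (2 * 7 ^ 5 : ℕ))) l :=
  FreyP6Engine.condP6_ratPoint_of_certificate_list (7 ^ 5 + 4) (2 * 7 ^ 5) (by norm_num) (by norm_num) (by norm_num)
    3 (by norm_num) not_dvd_c₄_3 4 (by norm_num) _ Δ_eq_3 not_dvd_D_3 5 (by norm_num) (by rw [FreyP6Engine.Δ_model]; norm_num) (-2) frobeniusTrace_5
    [11, 19, 23, 31, 43, 47, 59, 67, 71, 79, 83, 103, 107] (by decide +kernel) (by decide +kernel)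

/-- **(P6) at `ratPoint (((7 ^ 5 + 4 : ℕ) : ℚ) / (2 * 7 ^ 5 : ℕ))` for `l ∈ [13, 17, 41, 61, 73, 89, 97, 101]`** —
multiplicative prime `3` (`ord Δ = 4`), Frobenius certificate `p = 11` (`a_11 = -4`; `X² − a_11X + 11` rootless mod each
listed `l`, ONE kernel `decide` over `ℕ`). [cite: Mochizuki2012, IUTchIV Cor. 2.2 (ii) (P6) p.46] -/
theorem condP6_of_mem_q3_p11 :
    ∀ l ∈ ([13, 17, 41, 61, 73, 89, 97, 101] : List ℕ),
      Cor22.CondP6 (ratPoint (((7 ^ 5 + 4 : ℕ) : ℚ) / (2 * 7 ^ 5 : ℕ))) l :=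
  FreyP6Engine.condP6_ratPoint_of_certificate_list (7 ^ 5 + 4) (2 * 7 ^ 5) (by norm_num) (by norm_num) (by norm_num)
    3 (by norm_num) not_dvd_c₄_3 4 (by norm_num) _ Δ_eq_3 not_dvd_D_3 11 (by norm_num) (by rw [FreyP6Engine.Δ_model]; norm_num) (-4) frobeniusTrace_11
    [13, 17, 41, 61, 73, 89, 97, 101] (by decide +kernel) (by decide +kernel)

/-- **(P6) at `ratPoint (((7 ^ 5 + 4 : ℕ) : ℚ) / (2 * 7 ^ 5 : ℕ))` for `l ∈ [29, 37, 53]`** —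
multiplicative prime `3` (`ord Δ = 4`), Frobenius certificate `p = 17` (`a_17 = -6`; `X² − a_17X + 17` rootless mod each
listed `l`, ONE kernel `decide` over `ℕ`). [cite: Mochizuki2012, IUTchIV Cor. 2.2 (ii) (P6) p.46] -/
theorem condP6_of_mem_q3_p17 :
    ∀ l ∈ ([29, 37, 53] : List ℕ),
      Cor22.CondP6 (ratPoint (((7 ^ 5 + 4 : ℕ) : ℚ) / (2 * 7 ^ 5 : ℕ))) l :=
  FreyP6Engine.condP6_ratPoint_of_certificate_list (7 ^ 5 + 4) (2 * 7 ^ 5) (by norm_num) (by norm_num) (by norm_num)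
    3 (by norm_num) not_dvd_c₄_3 4 (by norm_num) _ Δ_eq_3 not_dvd_D_3 17 (by norm_num) (by rw [FreyP6Engine.Δ_model]; norm_num) (-6) frobeniusTrace_17
    [29, 37, 53] (by decide +kernel) (by decide +kernel)

/-- **(P6) HOLDS at `ratPoint (((7 ^ 5 + 4 : ℕ) : ℚ) / (2 * 7 ^ 5 : ℕ))` for EVERY tabulated `l`** of the R-W WINDOW-TABLE at this datum (24 primes,
`11 ≤ l ≤ 107`): `Cor22.CondP6 (ratPoint λ) l` — the image of `Gal(F̄/F)` on `E_F[l]` contains `SL₂(𝔽_l)` for every theta-field `F`.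
Certificate primes [5, 11, 17]; multiplicative prime(s) [3]. [cite: Mochizuki2012, IUTchIV Cor. 2.2 (ii) (P6) p.46] -/
theorem condP6_tabulated' :
    ∀ l ∈ ([11, 13, 17, 19, 23, 29, 31, 37, 41, 43, 47, 53, 59, 61, 67, 71, 73, 79, 83, 89, 97, 101, 103, 107] : List ℕ),
      Cor22.CondP6 (ratPoint (((7 ^ 5 + 4 : ℕ) : ℚ) / (2 * 7 ^ 5 : ℕ))) l := by
  have hsplit : ∀ l ∈ ([11, 13, 17, 19, 23, 29, 31, 37, 41, 43, 47, 53, 59, 61, 67, 71, 73, 79, 83, 89, 97, 101, 103, 107] : List ℕ),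
      l ∈ ([11, 19, 23, 31, 43, 47, 59, 67, 71, 79, 83, 103, 107] : List ℕ) ∨
      l ∈ ([13, 17, 41, 61, 73, 89, 97, 101] : List ℕ) ∨
      l ∈ ([29, 37, 53] : List ℕ) := by
    decide +kernel
  intro l hl
  rcases hsplit l hl with h | h | h
  · exact condP6_of_mem_q3_p5 l h
  · exact condP6_of_mem_q3_p11 l h
  · exact condP6_of_mem_q3_p17 l h

/-- **(P6) at `ratPoint ((2 : ℚ)⁻¹ + 2 / 7 ^ 5)`** — the tree's spelling of this datum (`(2 : ℚ)⁻¹ + 2 / 7 ^ 5 = (7 ^ 5 + 4)/(2 * 7 ^ 5)`, `norm_num`) — for every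
tabulated `l`: `condP6_tabulated'` transported along the equality of the rational numbers. [cite: Mochizuki2012, IUTchIV Cor. 2.2 (ii) (P6) p.46] -/
theorem condP6_tabulated :
    ∀ l ∈ ([11, 13, 17, 19, 23, 29, 31, 37, 41, 43, 47, 53, 59, 61, 67, 71, 73, 79, 83, 89, 97, 101, 103, 107] : List ℕ),
      Cor22.CondP6 (ratPoint ((2 : ℚ)⁻¹ + 2 / 7 ^ 5)) l := by
  have hq : ((2 : ℚ)⁻¹ + 2 / 7 ^ 5) = (((7 ^ 5 + 4 : ℕ) : ℚ) / (2 * 7 ^ 5 : ℕ)) := by norm_num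
  rw [hq]
  exact condP6_tabulated'

end FreyP6Hex5

namespace FreyP6Hex6

/-! ## Datum `λ = (7 ^ 6 + 4)/(2 * 7 ^ 6)` (`a + b = c` with `b = c − a`); model `E₁ = [0, −(c²+ac), 0, ac³, 0]` -/

/-- `3 ∤ c₄(E₁)` (`c₄ = 16c²(c²−ac+a²)`, `3 ∣ b = c − a`, `gcd(a,c) = 1`). [cite: SilvermanAEC2009, VII.5 Prop. 5.1(b)] -/
theorem not_dvd_c₄_3 : ¬ ((3 : ℕ) : ℤ) ∣ ((
      ⟨0, -(((2 * 7 ^ 6 : ℕ) : ℤ) ^ 2 + (7 ^ 6 + 4 : ℕ) * (2 * 7 ^ 6 : ℕ)), 0,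
        ((7 ^ 6 + 4 : ℕ) : ℤ) * ((2 * 7 ^ 6 : ℕ) : ℤ) ^ 3, 0⟩ : WeierstrassCurve ℤ)).c₄ := by
  rw [FreyP6Engine.c₄_model]; norm_num

/-- `Δ(E₁) = 16a²c⁸b² = 3^2 · D` (`ord_3 b = 1`). [cite: SilvermanAEC2009, III.1 Table 3.1] -/
theorem Δ_eq_3 : ((
      ⟨0, -(((2 * 7 ^ 6 : ℕ) : ℤ) ^ 2 + (7 ^ 6 + 4 : ℕ) * (2 * 7 ^ 6 : ℕ)), 0,
        ((7 ^ 6 + 4 : ℕ) : ℤ) * ((2 * 7 ^ 6 : ℕ) : ℤ) ^ 3, 0⟩ : WeierstrassCurve ℤ)).Δ =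
      (3 : ℕ) ^ 2 * (16 * ((7 ^ 6 + 4 : ℕ) : ℤ) ^ 2 * ((2 * 7 ^ 6 : ℕ) : ℤ) ^ 8 * (39215 : ℤ) ^ 2) := by
  rw [FreyP6Engine.Δ_model]; norm_num

/-- `3 ∤ D`. [folklore] -/
theorem not_dvd_D_3 : ¬ ((3 : ℕ) : ℤ) ∣ (16 * ((7 ^ 6 + 4 : ℕ) : ℤ) ^ 2 * ((2 * 7 ^ 6 : ℕ) : ℤ) ^ 8 * (39215 : ℤ) ^ 2) := by
  norm_num

/-- `a_13(E₁) = 13 + 1 − #Ẽ₁(𝔽_13) = 13 + 1 − 16 = -2`: `E₁ mod 13 = [0, 2, 0, 2, 0]` (`decide +kernel`) and the point count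
`#Ẽ₁(𝔽_13) = 16` is a KERNEL computation (Euler's criterion, `card_sol_eq_sum_euler` / `natCard_point_eq_one_add_card`). [folklore] -/
theorem frobeniusTrace_13 : Literature.NumberTheory.Automorphic.frobeniusTrace
    (
      ⟨0, -(((2 * 7 ^ 6 : ℕ) : ℤ) ^ 2 + (7 ^ 6 + 4 : ℕ) * (2 * 7 ^ 6 : ℕ)), 0,
        ((7 ^ 6 + 4 : ℕ) : ℤ) * ((2 * 7 ^ 6 : ℕ) : ℤ) ^ 3, 0⟩ : WeierstrassCurve ℤ) 13 = -2 := by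
  have hm : ((
      ⟨0, -(((2 * 7 ^ 6 : ℕ) : ℤ) ^ 2 + (7 ^ 6 + 4 : ℕ) * (2 * 7 ^ 6 : ℕ)), 0,
        ((7 ^ 6 + 4 : ℕ) : ℤ) * ((2 * 7 ^ 6 : ℕ) : ℤ) ^ 3, 0⟩ : WeierstrassCurve ℤ)).map (Int.castRingHom (ZMod 13)) = ⟨0, 2, 0, 2, 0⟩ := by
    ext <;> decide +kernel
  have hc : Nat.card (⟨0, 2, 0, 2, 0⟩ : WeierstrassCurve (ZMod 13)).toAffine.Point = 16 := by
    rw [@WeierstrassCurve.natCard_point_eq_one_add_card (ZMod 13) (@ZMod.instField 13 ⟨by norm_num⟩) _ _ _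
      (by decide +kernel), @card_sol_eq_sum_euler (ZMod 13) (@ZMod.instField 13 ⟨by norm_num⟩) _ _
      (by rw [ZMod.ringChar_zmod_n]; decide)]
    decide +kernel
  rw [Literature.NumberTheory.Automorphic.frobeniusTrace, Literature.NumberTheory.Automorphic.numPointsMod,
    hm, hc]; norm_num

/-- `a_17(E₁) = 17 + 1 − #Ẽ₁(𝔽_17) = 17 + 1 − 16 = 2`: `E₁ mod 17 = [0, 3, 0, 13, 0]` (`decide +kernel`) and the point count
`#Ẽ₁(𝔽_17) = 16` is a KERNEL computation (Euler's criterion, `card_sol_eq_sum_euler` / `natCard_point_eq_one_add_card`). [folklore] -/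
theorem frobeniusTrace_17 : Literature.NumberTheory.Automorphic.frobeniusTrace
    (
      ⟨0, -(((2 * 7 ^ 6 : ℕ) : ℤ) ^ 2 + (7 ^ 6 + 4 : ℕ) * (2 * 7 ^ 6 : ℕ)), 0,
        ((7 ^ 6 + 4 : ℕ) : ℤ) * ((2 * 7 ^ 6 : ℕ) : ℤ) ^ 3, 0⟩ : WeierstrassCurve ℤ) 17 = 2 := by
  have hm : ((
      ⟨0, -(((2 * 7 ^ 6 : ℕ) : ℤ) ^ 2 + (7 ^ 6 + 4 : ℕ) * (2 * 7 ^ 6 : ℕ)), 0,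
        ((7 ^ 6 + 4 : ℕ) : ℤ) * ((2 * 7 ^ 6 : ℕ) : ℤ) ^ 3, 0⟩ : WeierstrassCurve ℤ)).map (Int.castRingHom (ZMod 17)) = ⟨0, 3, 0, 13, 0⟩ := by
    ext <;> decide +kernel
  have hc : Nat.card (⟨0, 3, 0, 13, 0⟩ : WeierstrassCurve (ZMod 17)).toAffine.Point = 16 := by
    rw [@WeierstrassCurve.natCard_point_eq_one_add_card (ZMod 17) (@ZMod.instField 17 ⟨by norm_num⟩) _ _ _
      (by decide +kernel), @card_sol_eq_sum_euler (ZMod 17) (@ZMod.instField 17 ⟨by norm_num⟩) _ _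
      (by rw [ZMod.ringChar_zmod_n]; decide)]
    decide +kernel
  rw [Literature.NumberTheory.Automorphic.frobeniusTrace, Literature.NumberTheory.Automorphic.numPointsMod,
    hm, hc]; norm_num

/-- `a_41(E₁) = 41 + 1 − #Ẽ₁(𝔽_41) = 41 + 1 − 48 = -6`: `E₁ mod 41 = [0, 23, 0, 17, 0]` (`decide +kernel`) and the point count
`#Ẽ₁(𝔽_41) = 48` is a KERNEL computation (Euler's criterion, `card_sol_eq_sum_euler` / `natCard_point_eq_one_add_card`). [folklore] -/
theorem frobeniusTrace_41 : Literature.NumberTheory.Automorphic.frobeniusTrace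
    (
      ⟨0, -(((2 * 7 ^ 6 : ℕ) : ℤ) ^ 2 + (7 ^ 6 + 4 : ℕ) * (2 * 7 ^ 6 : ℕ)), 0,
        ((7 ^ 6 + 4 : ℕ) : ℤ) * ((2 * 7 ^ 6 : ℕ) : ℤ) ^ 3, 0⟩ : WeierstrassCurve ℤ) 41 = -6 := by
  have hm : ((
      ⟨0, -(((2 * 7 ^ 6 : ℕ) : ℤ) ^ 2 + (7 ^ 6 + 4 : ℕ) * (2 * 7 ^ 6 : ℕ)), 0,
        ((7 ^ 6 + 4 : ℕ) : ℤ) * ((2 * 7 ^ 6 : ℕ) : ℤ) ^ 3, 0⟩ : WeierstrassCurve ℤ)).map (Int.castRingHom (ZMod 41)) = ⟨0, 23, 0, 17, 0⟩ := by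
    ext <;> decide +kernel
  have hc : Nat.card (⟨0, 23, 0, 17, 0⟩ : WeierstrassCurve (ZMod 41)).toAffine.Point = 48 := by
    rw [@WeierstrassCurve.natCard_point_eq_one_add_card (ZMod 41) (@ZMod.instField 41 ⟨by norm_num⟩) _ _ _
      (by decide +kernel), @card_sol_eq_sum_euler (ZMod 41) (@ZMod.instField 41 ⟨by norm_num⟩) _ _
      (by rw [ZMod.ringChar_zmod_n]; decide)]
    decide +kernel
  rw [Literature.NumberTheory.Automorphic.frobeniusTrace, Literature.NumberTheory.Automorphic.numPointsMod,
    hm, hc]; norm_num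

/-- `a_43(E₁) = 43 + 1 − #Ẽ₁(𝔽_43) = 43 + 1 − 40 = 4`: `E₁ mod 43 = [0, 29, 0, 40, 0]` (`decide +kernel`) and the point count
`#Ẽ₁(𝔽_43) = 40` is a KERNEL computation (Euler's criterion, `card_sol_eq_sum_euler` / `natCard_point_eq_one_add_card`). [folklore] -/
theorem frobeniusTrace_43 : Literature.NumberTheory.Automorphic.frobeniusTrace
    (
      ⟨0, -(((2 * 7 ^ 6 : ℕ) : ℤ) ^ 2 + (7 ^ 6 + 4 : ℕ) * (2 * 7 ^ 6 : ℕ)), 0,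
        ((7 ^ 6 + 4 : ℕ) : ℤ) * ((2 * 7 ^ 6 : ℕ) : ℤ) ^ 3, 0⟩ : WeierstrassCurve ℤ) 43 = 4 := by
  have hm : ((
      ⟨0, -(((2 * 7 ^ 6 : ℕ) : ℤ) ^ 2 + (7 ^ 6 + 4 : ℕ) * (2 * 7 ^ 6 : ℕ)), 0,
        ((7 ^ 6 + 4 : ℕ) : ℤ) * ((2 * 7 ^ 6 : ℕ) : ℤ) ^ 3, 0⟩ : WeierstrassCurve ℤ)).map (Int.castRingHom (ZMod 43)) = ⟨0, 29, 0, 40, 0⟩ := by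
    ext <;> decide +kernel
  have hc : Nat.card (⟨0, 29, 0, 40, 0⟩ : WeierstrassCurve (ZMod 43)).toAffine.Point = 40 := by
    rw [@WeierstrassCurve.natCard_point_eq_one_add_card (ZMod 43) (@ZMod.instField 43 ⟨by norm_num⟩) _ _ _
      (by decide +kernel), @card_sol_eq_sum_euler (ZMod 43) (@ZMod.instField 43 ⟨by norm_num⟩) _ _
      (by rw [ZMod.ringChar_zmod_n]; decide)]
    decide +kernel
  rw [Literature.NumberTheory.Automorphic.frobeniusTrace, Literature.NumberTheory.Automorphic.numPointsMod,
    hm, hc]; norm_num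

/-- **(P6) at `ratPoint (((7 ^ 6 + 4 : ℕ) : ℚ) / (2 * 7 ^ 6 : ℕ))` for `l ∈ [11, 17, 23, 29, 41, 47, 53, 59, 71, 83, 89, 101, 107]`** —
multiplicative prime `3` (`ord Δ = 2`), Frobenius certificate `p = 13` (`a_13 = -2`; `X² − a_13X + 13` rootless mod each
listed `l`, ONE kernel `decide` over `ℕ`). [cite: Mochizuki2012, IUTchIV Cor. 2.2 (ii) (P6) p.46] -/
theorem condP6_of_mem_q3_p13 :
    ∀ l ∈ ([11, 17, 23, 29, 41, 47, 53, 59, 71, 83, 89, 101, 107] : List ℕ),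
      Cor22.CondP6 (ratPoint (((7 ^ 6 + 4 : ℕ) : ℚ) / (2 * 7 ^ 6 : ℕ))) l :=
  FreyP6Engine.condP6_ratPoint_of_certificate_list (7 ^ 6 + 4) (2 * 7 ^ 6) (by norm_num) (by norm_num) (by norm_num)
    3 (by norm_num) not_dvd_c₄_3 2 (by norm_num) _ Δ_eq_3 not_dvd_D_3 13 (by norm_num) (by rw [FreyP6Engine.Δ_model]; norm_num) (-2) frobeniusTrace_13
    [11, 17, 23, 29, 41, 47, 53, 59, 71, 83, 89, 101, 107] (by decide +kernel) (by decide +kernel)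

/-- **(P6) at `ratPoint (((7 ^ 6 + 4 : ℕ) : ℚ) / (2 * 7 ^ 6 : ℕ))` for `l ∈ [13, 37, 61]`** —
multiplicative prime `3` (`ord Δ = 2`), Frobenius certificate `p = 41` (`a_41 = -6`; `X² − a_41X + 41` rootless mod each
listed `l`, ONE kernel `decide` over `ℕ`). [cite: Mochizuki2012, IUTchIV Cor. 2.2 (ii) (P6) p.46] -/
theorem condP6_of_mem_q3_p41 :
    ∀ l ∈ ([13, 37, 61] : List ℕ),
      Cor22.CondP6 (ratPoint (((7 ^ 6 + 4 : ℕ) : ℚ) / (2 * 7 ^ 6 : ℕ))) l :=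
  FreyP6Engine.condP6_ratPoint_of_certificate_list (7 ^ 6 + 4) (2 * 7 ^ 6) (by norm_num) (by norm_num) (by norm_num)
    3 (by norm_num) not_dvd_c₄_3 2 (by norm_num) _ Δ_eq_3 not_dvd_D_3 41 (by norm_num) (by rw [FreyP6Engine.Δ_model]; norm_num) (-6) frobeniusTrace_41
    [13, 37, 61] (by decide +kernel) (by decide +kernel)

/-- **(P6) at `ratPoint (((7 ^ 6 + 4 : ℕ) : ℚ) / (2 * 7 ^ 6 : ℕ))` for `l ∈ [19, 31, 43, 67, 79, 103]`** —
multiplicative prime `3` (`ord Δ = 2`), Frobenius certificate `p = 17` (`a_17 = 2`; `X² − a_17X + 17` rootless mod each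
listed `l`, ONE kernel `decide` over `ℕ`). [cite: Mochizuki2012, IUTchIV Cor. 2.2 (ii) (P6) p.46] -/
theorem condP6_of_mem_q3_p17 :
    ∀ l ∈ ([19, 31, 43, 67, 79, 103] : List ℕ),
      Cor22.CondP6 (ratPoint (((7 ^ 6 + 4 : ℕ) : ℚ) / (2 * 7 ^ 6 : ℕ))) l :=
  FreyP6Engine.condP6_ratPoint_of_certificate_list (7 ^ 6 + 4) (2 * 7 ^ 6) (by norm_num) (by norm_num) (by norm_num)
    3 (by norm_num) not_dvd_c₄_3 2 (by norm_num) _ Δ_eq_3 not_dvd_D_3 17 (by norm_num) (by rw [FreyP6Engine.Δ_model]; norm_num) 2 frobeniusTrace_17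
    [19, 31, 43, 67, 79, 103] (by decide +kernel) (by decide +kernel)

/-- **(P6) at `ratPoint (((7 ^ 6 + 4 : ℕ) : ℚ) / (2 * 7 ^ 6 : ℕ))` for `l ∈ [73, 97]`** —
multiplicative prime `3` (`ord Δ = 2`), Frobenius certificate `p = 43` (`a_43 = 4`; `X² − a_43X + 43` rootless mod each
listed `l`, ONE kernel `decide` over `ℕ`). [cite: Mochizuki2012, IUTchIV Cor. 2.2 (ii) (P6) p.46] -/
theorem condP6_of_mem_q3_p43 :
    ∀ l ∈ ([73, 97] : List ℕ),
      Cor22.CondP6 (ratPoint (((7 ^ 6 + 4 : ℕ) : ℚ) / (2 * 7 ^ 6 : ℕ))) l :=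
  FreyP6Engine.condP6_ratPoint_of_certificate_list (7 ^ 6 + 4) (2 * 7 ^ 6) (by norm_num) (by norm_num) (by norm_num)
    3 (by norm_num) not_dvd_c₄_3 2 (by norm_num) _ Δ_eq_3 not_dvd_D_3 43 (by norm_num) (by rw [FreyP6Engine.Δ_model]; norm_num) 4 frobeniusTrace_43
    [73, 97] (by decide +kernel) (by decide +kernel)

/-- **(P6) HOLDS at `ratPoint (((7 ^ 6 + 4 : ℕ) : ℚ) / (2 * 7 ^ 6 : ℕ))` for EVERY tabulated `l`** of the R-W WINDOW-TABLE at this datum (24 primes,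
`11 ≤ l ≤ 107`): `Cor22.CondP6 (ratPoint λ) l` — the image of `Gal(F̄/F)` on `E_F[l]` contains `SL₂(𝔽_l)` for every theta-field `F`.
Certificate primes [13, 17, 41, 43]; multiplicative prime(s) [3]. [cite: Mochizuki2012, IUTchIV Cor. 2.2 (ii) (P6) p.46] -/
theorem condP6_tabulated' :
    ∀ l ∈ ([11, 13, 17, 19, 23, 29, 31, 37, 41, 43, 47, 53, 59, 61, 67, 71, 73, 79, 83, 89, 97, 101, 103, 107] : List ℕ),
      Cor22.CondP6 (ratPoint (((7 ^ 6 + 4 : ℕ) : ℚ) / (2 * 7 ^ 6 : ℕ))) l := by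
  have hsplit : ∀ l ∈ ([11, 13, 17, 19, 23, 29, 31, 37, 41, 43, 47, 53, 59, 61, 67, 71, 73, 79, 83, 89, 97, 101, 103, 107] : List ℕ),
      l ∈ ([11, 17, 23, 29, 41, 47, 53, 59, 71, 83, 89, 101, 107] : List ℕ) ∨
      l ∈ ([13, 37, 61] : List ℕ) ∨
      l ∈ ([19, 31, 43, 67, 79, 103] : List ℕ) ∨
      l ∈ ([73, 97] : List ℕ) := by
    decide +kernel
  intro l hl
  rcases hsplit l hl with h | h | h | h
  · exact condP6_of_mem_q3_p13 l h
  · exact condP6_of_mem_q3_p41 l h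
  · exact condP6_of_mem_q3_p17 l h
  · exact condP6_of_mem_q3_p43 l h

/-- **(P6) at `ratPoint ((2 : ℚ)⁻¹ + 2 / 7 ^ 6)`** — the tree's spelling of this datum (`(2 : ℚ)⁻¹ + 2 / 7 ^ 6 = (7 ^ 6 + 4)/(2 * 7 ^ 6)`, `norm_num`) — for every
tabulated `l`: `condP6_tabulated'` transported along the equality of the rational numbers. [cite: Mochizuki2012, IUTchIV Cor. 2.2 (ii) (P6) p.46] -/
theorem condP6_tabulated :
    ∀ l ∈ ([11, 13, 17, 19, 23, 29, 31, 37, 41, 43, 47, 53, 59, 61, 67, 71, 73, 79, 83, 89, 97, 101, 103, 107] : List ℕ),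
      Cor22.CondP6 (ratPoint ((2 : ℚ)⁻¹ + 2 / 7 ^ 6)) l := by
  have hq : ((2 : ℚ)⁻¹ + 2 / 7 ^ 6) = (((7 ^ 6 + 4 : ℕ) : ℚ) / (2 * 7 ^ 6 : ℕ)) := by norm_num
  rw [hq]
  exact condP6_tabulated'

end FreyP6Hex6
end Summit.ABC.IUTFork.Conditional

end
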